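/-
Copyright (c) 2026. All rights reserved.
Released under Apache 2.0 license as described in the file LICENSE.
-/
import Literature.AlgebraicGeometry.Pohlmann1968.MultiquadraticCMFieldWeilSubfields
import Literature.AlgebraicGeometry.Pohlmann1968.MultiquadraticCMFieldWeilLinesCount
import Literature.AlgebraicGeometry.Pohlmann1968.MultiquadraticCMFieldPrimitiveNearBentTypes
import HarnessLib

/-!
# Exceptional Weil classes in codimension `g/4`: every realisation of a primitive CM type of a multiquadratic CM field
# of degree `2g` carries at least `4·C(g + 1 − Rank, 2)` independent exceptional Hodge classes in `H^{g/2}` — the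
# Weil classes of its biquadratic Weil CM subfields (Moonen–Zarhin); degree `32`: `dim B⁴ − dim D⁴ ≥ 60`

SETTING (tree `MultiquadraticCMFieldWeilSubfields`, `MultiquadraticCMFieldWeilLinesCount`, `WeilTypeCMSubfieldExceptionalClasses`,
`DivisorClassesCMType`).  `K` a CM field, Galois over `ℚ` with `Gal(K/ℚ)` of exponent `2`, `[K:ℚ] = 2g = 8m`; `Φ` a
PRIMITIVE CM type (its abelian varieties are simple, Shimura §8.2 Prop. 26); `A` any realisation of `(K; Φ)`;
`w = g + 1 − Rank(Φ)` the number of imaginary quadratic subfields over which `Φ` is balanced (Kubota–Dodson, tree).  For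
a subfield `L ⊆ End⁰(A) = K` with equal multiplicities `n_σ = n_σ̄` the space of Weil classes
`W_L = ⋀_L^{[K:L]} H¹(A, ℚ) ⊆ H^{[K:L]}(A, ℚ)` consists of Hodge classes, EXCEPTIONAL (outside the ring `D•(A)` of divisor
classes) iff `L` is not totally real — B. Moonen, Yu. Zarhin [MoonenZarhin1998WeilClasses] Criteria (Q1), (Q2); in
Pohlmann's eigen-weight dictionary (B. B. Gordon [Gordon1999HodgeAVSurvey] 9.2.2, White's count
`dim Bᵖ − dim Dᵖ = #(pohlmannSets ∖ pohlmannDivisorSets)`, tree) `W_L ⊗ ℂ` is spanned by the weight lines of the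
`[L:ℚ]` FIBRES of `Hom(K, ℂ) → Hom(L, ℂ)` (tree `fibre_mem_pohlmannSets_diff`).  gen-45 counted the fibres of the `w`
imaginary quadratic Weil subfields (middle degree `p = g/2`); g46-#2 showed that the BIQUADRATIC Weil subfields are the
`C(w, 2)` composita `F₁F₂` of pairs of Weil imaginary quadratic subfields.  THIS FILE counts their Weil lines:

> **Theorem** (`four_mul_choose_le_finrank_sub`, ★).  `[K:ℚ] = 8m`, `Φ` primitive, `A` any realisation of `(K; Φ)`:
> **`dim Bᵐ(A) ⊗ ℂ − dim Dᵐ(A) ⊗ ℂ ≥ 4 · C([K:ℚ]/2 + 1 − Rank(Φ), 2)`** — four exceptional Weil lines in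
> `H^{2m}(A) = H^{g/2}(A)` (codimension `g/4`) for every biquadratic CM subfield `L` over which `A` is of Weil type; the
> fibres over `Hom(L, ℂ)` are the cosets of `Gal(K/L)`, pairwise distinct over all `L` (`ncard_cosets_eq_four_mul`).
> Variants `…_of_twistStabilizer_eq_bot`, `…_of_isSimple`; `exists_exceptional_quarter` (one such class as soon as `Φ`
> has two Weil imaginary quadratic subfields, i.e. `Rank(Φ) ≤ g − 1`).
> **Theorem** (`sixty_le_finrank_sub_of_finrank_eq_thirtytwo`, DEGREE `32`).  EVERY SIMPLE DEGENERATE abelian `16`-fold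
> `A` with complex multiplication by `K` (rank `11`, six Weil imaginary quadratic subfields, fifteen Weil biquadratic
> subfields) has **`dim B⁴(A) − dim D⁴(A) ≥ 60`**: sixty independent exceptional Weil classes in CODIMENSION `4`
> (`H⁸(A) = H^{4,4}`), and a rational `(4,4)`-class outside `D⁴(A) ⊗ ℂ` (`exists_exceptional_four_of_finrank_eq_thirtytwo`);
> such `A` exist on every `K` (`exists_isSimple_sixteenfold_sixty_of_finrank_eq_thirtytwo`).  (gen 45 knew only the middle
> cohomology `H¹⁶`, `≥ 12` lines; a census of the seat — not formalised — gives the exact values `dim B⁴ − dim D⁴ = 1740`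
> and `dim B² − dim D² = 24` for these `16`-folds.)
> **Theorem** (`four_hundred_eighty_le_finrank_sub_of_finrank_eq_sixtyFour`, DEGREE `64`).  For a primitive CM type of
> rank `17` (e.g. the primitive NEAR-BENT types, tree) every abelian variety of type `(K; Φ)` — a simple `32`-fold — has
> **`dim B⁸(A) − dim D⁸(A) ≥ 480`** (codimension `8`); existence `exists_isSimple_thirtyTwofold_fourHundredEighty_of_finrank_eq_sixtyFour`.

HONEST SCOPE.  Lower bounds only (the remaining exceptional classes — products with divisor monomials, Weil subfields
of degree `8`, and unions of cosets — are not counted here); the algebraicity of these Weil classes (the Hodge conjecture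
for these simple CM `16`- and `32`-folds) is OPEN and not addressed: Weil classes are known algebraic only on abelian
FOURFOLDS of Weil type and some sixfolds (C. Schoen, B. van Geemen, K. Koike, E. Markman — imaginary QUADRATIC `L`,
`dim A ≤ 6`; E. Markman [Markman2025SecantWeil] §1.1), nothing is known for `L` of degree `4` acting on a `16`-fold.
THEOREMS ONLY: no definition, no named fact, no instance, no `sorry`.

## References

* [MoonenZarhin1998WeilClasses] B. J. J. Moonen, Yu. G. Zarhin, *Weil classes on abelian varieties*, J. reine angew.
  Math. 496 (1998) 83–92: Criterion (Q1), Criterion (Q2) (type IV, `d = m = 1`), Remark (1).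
* [Gordon1999HodgeAVSurvey] B. B. Gordon, *A survey of the Hodge conjecture for abelian varieties*, 5.13 (ii), 9.2.2
  (White's count), §9.3, 9.4.3.
* [Pohlmann1968] H. Pohlmann, *Algebraic cycles on abelian varieties of complex multiplication type*, Ann. of Math. 88
  (1968), Thm. 1.
* [vanGeemen1994HodgeAV] B. van Geemen, *An introduction to the Hodge conjecture for abelian varieties*, LNM 1594, 4.7,
  Thm. 4.5.
* [Dodson1984] B. Dodson, *The structure of Galois groups of CM-fields*, Trans. AMS 283 (1984), §3.1.1 Theorem, §3.2.1.
* [Kubota1965] T. Kubota, *On the field extension by complex multiplication*, Trans. AMS 118 (1965), §4 Lemma 2.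
* [Shimura1998] G. Shimura, *Abelian Varieties with Complex Multiplication and Modular Functions*, §6.2 Thm. 3, §8.2
  Prop. 26, §8.4 Example (1).

## Provenance

Lane `lit-hodgefound` (Track 2, Layer A4/A5), seat `lit-hodgefound-p10` generation 46, row g46-#3; neighbours cited by
name, nothing restated: `MultiquadraticWeilSubfields` (g46-#2: `filter_comp_eq_eq_image`, `forall_fibre_iff_forall_coset`,
`conjugate_comp_ne_of_not_isTotallyReal`, `card_filter_mul_mem_fixingSubgroup_eq_ncard`,
`ncard_indexFour_balanced_eq_choose_sub_cmTypeRank`, USED), `WeilTypeCMSubfieldExceptionalClasses`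
(`fibre_mem_pohlmannSets_diff`, USED), `DivisorClassesCMType` (`finrank_hodgeClassSpan_sub_finrank_divisorClassesSpan`,
`exists_exceptional_iff`), `MultiquadraticWeilLines` (g45-#8: degree-`32` facts), `Multiquadratic`
(`cmTypeRank_eq_eleven_of_isSimple_of_not_isNondegenerate`, `exists_isPrimitive_cmTypeRank_eq_eleven`,
`isSimple_iff_cmTypeRank_eq_eleven_or_seventeen`), `MultiquadraticPrimitiveNearBent` (g45-#6:
`exists_isSimple_exceptional_nearBent_of_finrank_eq_sixtyFour`), `Pohlmann1968.AbelianKernels`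
(`conjGal_not_mem_iff_not_isTotallyReal_fixedField`), `CyclicTwoOddPrimes` (`isCMTypeWith_galType`),
`BalancedCosets` (g46-#1), `CMAbelianVarietyRealisedHolds` (`exists_isCMTypeRealisation`).
-/

open scoped BigOperators NumberField IsMulCommutative Classical
open NumberField Module CategoryTheory CategoryTheory.Limits IntermediateField

namespace Literature.AlgebraicGeometry.Pohlmann1968

namespace MultiquadraticWeilSubfieldsClasses

open scoped Literature.NumberTheory.ComplexMultiplication
open Literature.NumberTheory.ComplexMultiplication (twistStabilizer IsCMTypeWith conjGal IsPrimitive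
  pattern_primitive_iff_twistStabilizer_eq_bot)
open Literature.AlgebraicGeometry.Pohlmann1968.MultiquadraticWeilSubfields (filter_comp_eq_eq_image
  forall_fibre_iff_forall_coset conjugate_comp_ne_of_not_isTotallyReal card_filter_mul_mem_fixingSubgroup_eq_ncard
  ncard_indexFour_balanced_eq_choose_sub_cmTypeRank)
open Literature.AlgebraicGeometry.Pohlmann1968.AbelianKernels (conjGal_not_mem_iff_not_isTotallyReal_fixedField
  index_eq_finrank_fixedField)
open Literature.AlgebraicGeometry.Pohlmann1968.CyclicTwoOddPrimes (isCMTypeWith_galType)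
open Literature.AlgebraicGeometry.Pohlmann1968.Multiquadratic
  (cmTypeRank_eq_eleven_of_isSimple_of_not_isNondegenerate isSimple_iff_cmTypeRank_eq_eleven_or_seventeen
  exists_isPrimitive_cmTypeRank_eq_eleven cmTypeRank_add_ncard_weilQuadratic_eq)
open Literature.AlgebraicGeometry.Pohlmann1968.MultiquadraticPrimitiveNearBent
  (exists_isSimple_exceptional_nearBent_of_finrank_eq_sixtyFour)
open Literature.AlgebraicGeometry.Motives (CMType AbelianVariety)
open Literature.AlgebraicGeometry.HodgeTheory
open Literature.AlgebraicGeometry.VanGeemen1994 (hodgeClassSpan)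
open Literature.Barriers.HodgeConjecture (divisorClassesSpan)
open Literature.AlgebraicGeometry.ComplexMultiplication (IsCMTypeRealisation exists_isCMTypeRealisation
  isPrimitive_ringEquiv_complex_iff isSimple_iff_isPrimitive)

/-! ## §0 Group level: the cosets of a family of index-`4` subgroups number `4·#family` -/

section Cosets

variable {G : Type*} [CommGroup G] [Fintype G] [DecidableEq G]

omit [DecidableEq G] in
/-- The translate `{u : x·u ∈ H}` has `|H|` elements. [folklore] -/
private theorem card_filter_univ_mul_mem_ec (H : Subgroup G) (x : G) :
    (Finset.univ.filter fun u : G => x * u ∈ H).card = Nat.card H := by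
  have e : Nat.card H = (Finset.univ.filter fun g : G => g ∈ H).card := by
    rw [Nat.card_eq_fintype_card, ← Fintype.card_subtype]
  rw [e]
  refine Finset.card_bij (fun u _ => x * u) (fun u hu => ?_) (fun a _ b _ hab => mul_left_cancel hab)
    (fun k hk => ⟨x⁻¹ * k, ?_, by rw [mul_inv_cancel_left]⟩)
  · simpa using hu
  · simpa using hk

omit [Fintype G] [DecidableEq G] in
/-- `g·g = 1` in exponent `2`. [folklore] -/
private theorem mul_self_ec (hexp : ∀ g : G, g ^ 2 = 1) (g : G) : g * g = 1 := by
  rw [← pow_two]; exact hexp g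

omit [DecidableEq G] in
/-- **Two cosets (as subsets `{t : x·t ∈ H}`, exponent `2`) coincide iff `x·y ∈ H`.** [folklore] -/
private theorem filter_eq_filter_iff_ec (hexp : ∀ g : G, g ^ 2 = 1) (H : Subgroup G) (x y : G) :
    (Finset.univ.filter fun t : G => x * t ∈ H) = (Finset.univ.filter fun t : G => y * t ∈ H) ↔ x * y ∈ H := by
  constructor
  · intro h
    have hy : y ∈ Finset.univ.filter fun t : G => y * t ∈ H := by
      simp only [Finset.mem_filter, Finset.mem_univ, true_and, mul_self_ec hexp]; exact H.one_mem
    rw [← h] at hy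
    simpa using hy
  · intro hxy
    ext t
    simp only [Finset.mem_filter, Finset.mem_univ, true_and]
    have e : y * t = (x * y) * (x * t) := by
      rw [mul_mul_mul_comm, mul_self_ec hexp, one_mul]
    constructor
    · intro hxt; rw [e]; exact H.mul_mem hxy hxt
    · intro hyt
      have := H.mul_mem hxy hyt
      rwa [e, ← mul_assoc, mul_self_ec hexp, one_mul] at this

omit [DecidableEq G] in
/-- **A coset determines its subgroup**: `{t : x·t ∈ H} = {t : y·t ∈ H'} ⟹ H = H'`. [folklore] -/
private theorem eq_of_filter_eq_filter_ec (hexp : ∀ g : G, g ^ 2 = 1) {H H' : Subgroup G} {x y : G}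
    (h : (Finset.univ.filter fun t : G => x * t ∈ H) = (Finset.univ.filter fun t : G => y * t ∈ H')) : H = H' := by
  have key : ∀ t : G, x * t ∈ H ↔ y * t ∈ H' := fun t => by
    have := Finset.ext_iff.1 h t
    simpa using this
  have hyx : y * x ∈ H' := (key x).1 (by rw [mul_self_ec hexp]; exact H.one_mem)
  have hxy : x * y ∈ H := (key y).2 (by rw [mul_self_ec hexp]; exact H'.one_mem)
  ext k
  constructor
  · intro hk
    have h1 : y * (x * k) ∈ H' := (key (x * k)).1 (by rw [← mul_assoc, mul_self_ec hexp, one_mul]; exact hk)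
    have := H'.mul_mem h1 (H'.inv_mem hyx)
    rwa [← mul_assoc, mul_inv_cancel_comm] at this
  · intro hk
    have h1 : x * (y * k) ∈ H := (key (y * k)).2 (by rw [← mul_assoc, mul_self_ec hexp, one_mul]; exact hk)
    have := H.mul_mem h1 (H.inv_mem hxy)
    rwa [← mul_assoc, mul_inv_cancel_comm] at this

/-- **A subgroup has `[G:H]` cosets** (counted as the distinct subsets `{t : x·t ∈ H}`). [folklore] -/
private theorem card_image_filter_eq_index_ec (hexp : ∀ g : G, g ^ 2 = 1) (H : Subgroup G) :
    (Finset.univ.image fun x : G => Finset.univ.filter fun t : G => x * t ∈ H).card = H.index := by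
  have hfib : ∀ C ∈ Finset.univ.image (fun x : G => Finset.univ.filter fun t : G => x * t ∈ H),
      (Finset.univ.filter fun y : G => (Finset.univ.filter fun t : G => y * t ∈ H) = C).card = Nat.card H := by
    intro C hC
    obtain ⟨x, -, rfl⟩ := Finset.mem_image.1 hC
    rw [← card_filter_univ_mul_mem_ec H x]
    congr 1
    ext y
    simp only [Finset.mem_filter, Finset.mem_univ, true_and]
    rw [filter_eq_filter_iff_ec hexp, mul_comm]
  have hsum := Finset.card_eq_sum_card_image (fun x : G => Finset.univ.filter fun t : G => x * t ∈ H) Finset.univ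
  rw [Finset.sum_congr rfl hfib, Finset.sum_const, smul_eq_mul, Finset.card_univ] at hsum
  have hci := H.card_mul_index
  rw [Nat.card_eq_fintype_card (α := G), hsum] at hci
  have hpos : 0 < Nat.card H := Nat.card_pos
  rw [mul_comm] at hci
  exact (Nat.eq_of_mul_eq_mul_right hpos hci).symm

/-- **THE COSETS OF A FAMILY OF INDEX-`4` SUBGROUPS NUMBER `4 · #family`** (cosets of distinct subgroups are distinct
subsets).  Field side: the fibres over the embeddings of the biquadratic Weil subfields are `4` per subfield and pairwise
distinct. [cite: Dodson1984, §3.1.1 (the Galois group `(ℤ/2)^{r+1}` of `ℚ(√−d, √a₁, …, √a_r)`)] -/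
theorem ncard_cosets_eq_four_mul (hexp : ∀ g : G, g ^ 2 = 1) (P : Subgroup G → Prop) :
    {C : Finset G | ∃ H : Subgroup G, H.index = 4 ∧ P H ∧ ∃ x : G, C = Finset.univ.filter fun t : G => x * t ∈ H}.ncard =
      4 * {H : Subgroup G | H.index = 4 ∧ P H}.ncard := by
  set S : Finset (Subgroup G) := Finset.univ.filter fun H : Subgroup G => H.index = 4 ∧ P H with hS
  have hSncard : {H : Subgroup G | H.index = 4 ∧ P H}.ncard = S.card := by
    rw [← Set.ncard_coe_finset]; congr 1; ext H; simp [hS]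
  set f : Subgroup G → Finset (Finset G) := fun H =>
    Finset.univ.image fun x : G => Finset.univ.filter fun t : G => x * t ∈ H with hf
  have hset : {C : Finset G | ∃ H : Subgroup G, H.index = 4 ∧ P H ∧
      ∃ x : G, C = Finset.univ.filter fun t : G => x * t ∈ H} = ↑(S.biUnion f) := by
    ext C
    simp only [Set.mem_setOf_eq, Finset.coe_biUnion, Finset.mem_coe, Set.mem_iUnion, hS, hf, Finset.mem_filter,
      Finset.mem_univ, true_and, Finset.mem_image, exists_prop]
    constructor
    · rintro ⟨H, hH, hP, x, rfl⟩
      exact ⟨H, ⟨hH, hP⟩, x, rfl⟩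
    · rintro ⟨H, ⟨hH, hP⟩, x, rfl⟩
      exact ⟨H, hH, hP, x, rfl⟩
  have hdisj : (S : Set (Subgroup G)).PairwiseDisjoint f := by
    intro H _ H' _ hne
    rw [Function.onFun, Finset.disjoint_left]
    intro C hC hC'
    simp only [hf, Finset.mem_image, Finset.mem_univ, true_and] at hC hC'
    obtain ⟨x, rfl⟩ := hC
    obtain ⟨y, hy⟩ := hC'
    exact hne (eq_of_filter_eq_filter_ec hexp hy.symm)
  rw [hset, Set.ncard_coe_finset, Finset.card_biUnion hdisj, hSncard]
  have hS4 : ∀ H ∈ S, (f H).card = 4 := by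
    intro H hH
    rw [hf, card_image_filter_eq_index_ec hexp H]
    exact (Finset.mem_filter.1 hH).2.1
  rw [Finset.sum_congr rfl hS4, Finset.sum_const, smul_eq_mul, mul_comm]

end Cosets

/-! ## §1 The fibres of the biquadratic Weil subfields are exceptional Pohlmann sets of degree `g/4` -/

section Fibres

variable {K : Type} [Field K] [NumberField K] [IsCMField K] [IsGalois ℚ K]

omit [IsGalois ℚ K] in
/-- `φ₀ ∘ ρ = conj ∘ φ₀`. [cite: Shimura1998, §18.2 Lemma (i)] -/
private theorem apply_conjGal_eq_ec (φ₀ : K →+* ℂ) (x : K) :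
    φ₀ ((conjGal : K ≃ₐ[ℚ] K) x) = starRingEnd ℂ (φ₀ x) :=
  AbelianCMFieldExistence.apply_conjGal_eq φ₀ x

/-- The group-level type `T_Φ` is a CM type of `Gal(K/ℚ)` w.r.t. `ρ`. [cite: Shimura1998, §8.1] -/
private theorem isCMTypeWith_T_ec (hexp : ∀ g : K ≃ₐ[ℚ] K, g ^ 2 = 1) (φ₀ : K →+* ℂ) (Φ : CMType K) :
    IsCMTypeWith (conjGal : K ≃ₐ[ℚ] K)
      (↑(Finset.univ.filter fun s : K ≃ₐ[ℚ] K => embOf φ₀ s ∈ Φ.1) : Set (K ≃ₐ[ℚ] K)) := by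
  haveI := Multiquadratic.isAbelianGalois_of_forall_sq_eq_one hexp
  exact isCMTypeWith_galType (apply_conjGal_eq_ec φ₀) Φ

omit [IsCMField K] in
/-- `|Gal(K/ℚ)| = [K:ℚ]`; an index-`4` subgroup has `8·|H| = 2[K:ℚ]`. [cite: Shimura1998, §8.1] -/
private theorem eight_mul_natCard_ec (φ₀ : K →+* ℂ) {H : Subgroup (K ≃ₐ[ℚ] K)} (hH : H.index = 4) :
    2 * Nat.card H = finrank ℚ K / 2 := by
  have h := H.card_mul_index
  rw [hH, Nat.card_eq_fintype_card (α := K ≃ₐ[ℚ] K), card_gal_eq_finrank φ₀] at h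
  omega

/-- **THE COSET-FIBRES OF AN INDEX-`4` SUBGROUP `H ∌ ρ` WITH BALANCED COSETS ARE EXCEPTIONAL POHLMANN SETS OF DEGREE
`[K:ℚ]/8`** (`Φ` primitive): the image `{σ_t : x·t ∈ H}` is the fibre of `Hom(K, ℂ) → Hom(L, ℂ)` over the non-real
embedding `σ_x|_L` of the biquadratic CM subfield `L = K^H` over which `Φ` is balanced — a Weil line of `(A, L)`
outside `D^{[K:ℚ]/8}(A) ⊗ ℂ`. [cite: MoonenZarhin1998WeilClasses, Criterion (Q1) and Criterion (Q2)]
[cite: Gordon1999HodgeAVSurvey, 9.2.2 and 5.13 (ii)] [cite: Pohlmann1968, Thm. 1] -/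
theorem image_coset_mem_pohlmannSets_diff (hexp : ∀ g : K ≃ₐ[ℚ] K, g ^ 2 = 1) (φ₀ : K →+* ℂ) (Φ : CMType K)
    (hprim : IsPrimitive (ℂ ≃+* ℂ) Φ.1 φ₀) {H : Subgroup (K ≃ₐ[ℚ] K)} (hH : H.index = 4)
    (hρ : (conjGal : K ≃ₐ[ℚ] K) ∉ H)
    (hbal : ∀ x : K ≃ₐ[ℚ] K, 2 * ((Finset.univ.filter fun s : K ≃ₐ[ℚ] K => embOf φ₀ s ∈ Φ.1).filter
      fun t => x * t ∈ H).card = Nat.card H)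
    (x : K ≃ₐ[ℚ] K) :
    (Finset.univ.filter fun t : K ≃ₐ[ℚ] K => x * t ∈ H).image (embOf φ₀) ∈
      pohlmannSets Φ (finrank ℚ K / 8) \ pohlmannDivisorSets Φ (finrank ℚ K / 8) := by
  haveI := Multiquadratic.isAbelianGalois_of_forall_sq_eq_one hexp
  set L : IntermediateField ℚ K := fixedField H with hLdef
  have hLH : L.fixingSubgroup = H := fixingSubgroup_fixedField H
  have hLr : ¬ IsTotallyReal L := (conjGal_not_mem_iff_not_isTotallyReal_fixedField H).1 hρ
  have hW : ∀ σ : L →+* ℂ, {φ : K →+* ℂ | φ.comp (algebraMap L K) = σ ∧ φ ∈ Φ.1}.ncard =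
      {φ : K →+* ℂ | φ.comp (algebraMap L K) = σ ∧ φ ∉ Φ.1}.ncard := by
    rw [forall_fibre_iff_forall_coset hexp φ₀ Φ L, hLH]; exact hbal
  have hne := conjugate_comp_ne_of_not_isTotallyReal hexp hLr ((embOf φ₀ x).comp (algebraMap L K))
  have hmem := fibre_mem_pohlmannSets_diff (algebraMap L K) φ₀ hprim hW hne
  have hdeg : {φ : K →+* ℂ | φ.comp (algebraMap L K) = (embOf φ₀ x).comp (algebraMap L K) ∧ φ ∈ Φ.1}.ncard =
      finrank ℚ K / 8 := by
    rw [← card_filter_mul_mem_fixingSubgroup_eq_ncard hexp φ₀ Φ L x, hLH]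
    have h1 := hbal x
    have h2 := eight_mul_natCard_ec φ₀ hH
    omega
  rw [hdeg, filter_comp_eq_eq_image hexp φ₀ L x, hLH] at hmem
  exact hmem

end Fibres

/-! ## §2 ★ The count: `dim B^{g/4·…}` — at least `4·C(w, 2)` exceptional Weil lines in `H^{g/2}(A)` -/

section Count

variable {K : Type} [Field K] [NumberField K] [IsCMField K] [IsGalois ℚ K]
  {A : AbelianVariety ℂ} {ι : 𝓞 K →+* End A} {θ : K →+* Module.End ℂ (complexBetti A.X 1)}

omit [IsCMField K] [IsGalois ℚ K] in
/-- `Finset.image` of an injective map is injective on finsets. [folklore] -/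
private theorem image_injective_ec {φ₀ : K →+* ℂ} (hinj : Function.Injective (embOf φ₀)) :
    Function.Injective fun C : Finset (K ≃ₐ[ℚ] K) => C.image (embOf φ₀) := by
  intro C C' h
  have h' : (embOf φ₀) '' (↑C : Set (K ≃ₐ[ℚ] K)) = (embOf φ₀) '' ↑C' := by
    rw [← Finset.coe_image, ← Finset.coe_image]; exact congrArg _ h
  exact Finset.coe_inj.1 (hinj.image_injective h')

/-- **★ `dim Bᵐ(A) − dim Dᵐ(A) ≥ 4·C([K:ℚ]/2 + 1 − Rank(Φ), 2)`, `8m = [K:ℚ]`, FOR EVERY REALISATION OF A PRIMITIVE CM TYPE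
OF A MULTIQUADRATIC CM FIELD** — four exceptional Weil lines in `H^{2m}(A)` (codimension `g/4`) for each of the
`C(w, 2)` biquadratic CM subfields over which `A` is of Weil type, `w = g + 1 − Rank(Φ)` (Kubota–Dodson).
[cite: MoonenZarhin1998WeilClasses, Criterion (Q1) and Criterion (Q2)] [cite: Gordon1999HodgeAVSurvey, 9.2.2 and 5.13 (ii)]
[cite: Pohlmann1968, Thm. 1] [cite: Dodson1984, §3.1.1 Theorem] -/
theorem four_mul_choose_le_finrank_sub (hexp : ∀ g : K ≃ₐ[ℚ] K, g ^ 2 = 1) (φ₀ : K →+* ℂ) (Φ : CMType K)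
    (hprim : IsPrimitive (ℂ ≃+* ℂ) Φ.1 φ₀) {m : ℕ} (hm : finrank ℚ K = 8 * m) (hA : IsCMTypeRealisation Φ A ι θ) :
    4 * Nat.choose (finrank ℚ K / 2 + 1 - cmTypeRank Φ) 2 ≤
      Module.finrank ℂ ↥(hodgeClassSpan (finrank ℚ K / 2) A.X m) -
        Module.finrank ℂ ↥(divisorClassesSpan A.X (finrank ℚ K / 2) m) := by
  haveI := Multiquadratic.isAbelianGalois_of_forall_sq_eq_one hexp
  rw [finrank_hodgeClassSpan_sub_finrank_divisorClassesSpan hA m, ← ncard_indexFour_balanced_eq_choose_sub_cmTypeRank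
    hexp φ₀ Φ, ← ncard_cosets_eq_four_mul hexp]
  have hm8 : finrank ℚ K / 8 = m := by rw [hm]; omega
  -- the coset family, pushed into `Hom(K, ℂ)` by `t ↦ σ_t`
  set 𝒞 : Set (Finset (K ≃ₐ[ℚ] K)) := {C | ∃ H : Subgroup (K ≃ₐ[ℚ] K), H.index = 4 ∧
      ((conjGal : K ≃ₐ[ℚ] K) ∉ H ∧ ∀ x : K ≃ₐ[ℚ] K, 2 * ((Finset.univ.filter fun s : K ≃ₐ[ℚ] K =>
        embOf φ₀ s ∈ Φ.1).filter fun t => x * t ∈ H).card = Nat.card H) ∧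
      ∃ x : K ≃ₐ[ℚ] K, C = Finset.univ.filter fun t : K ≃ₐ[ℚ] K => x * t ∈ H} with h𝒞
  have hsub : (fun C : Finset (K ≃ₐ[ℚ] K) => C.image (embOf φ₀)) '' 𝒞 ⊆
      pohlmannSets Φ m \ pohlmannDivisorSets Φ m := by
    rintro _ ⟨C, ⟨H, hH, ⟨hρ, hbal⟩, x, rfl⟩, rfl⟩
    rw [← hm8]
    exact image_coset_mem_pohlmannSets_diff hexp φ₀ Φ hprim hH hρ hbal x
  calc 𝒞.ncard = ((fun C : Finset (K ≃ₐ[ℚ] K) => C.image (embOf φ₀)) '' 𝒞).ncard :=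
        (Set.ncard_image_of_injective _ (image_injective_ec (embOf_bijective φ₀).1)).symm
    _ ≤ (pohlmannSets Φ m \ pohlmannDivisorSets Φ m).ncard := Set.ncard_le_ncard hsub (Set.toFinite _)

/-- The same for a CM type with TRIVIAL TWIST STABILISER (`Stab(Φ) = ⊥`). [cite: Shimura1998, §8.2 Prop. 26]
[cite: MoonenZarhin1998WeilClasses, Criterion (Q2)] -/
theorem four_mul_choose_le_finrank_sub_of_twistStabilizer_eq_bot (hexp : ∀ g : K ≃ₐ[ℚ] K, g ^ 2 = 1) (Φ : CMType K)
    (hbot : twistStabilizer Φ = ⊥) {m : ℕ} (hm : finrank ℚ K = 8 * m) (hA : IsCMTypeRealisation Φ A ι θ) :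
    4 * Nat.choose (finrank ℚ K / 2 + 1 - cmTypeRank Φ) 2 ≤
      Module.finrank ℂ ↥(hodgeClassSpan (finrank ℚ K / 2) A.X m) -
        Module.finrank ℂ ↥(divisorClassesSpan A.X (finrank ℚ K / 2) m) := by
  obtain ⟨φ₀⟩ := (inferInstance : Nonempty (K →+* ℂ))
  exact four_mul_choose_le_finrank_sub hexp φ₀ Φ
    ((isPrimitive_ringEquiv_complex_iff Φ φ₀).2 ((pattern_primitive_iff_twistStabilizer_eq_bot Φ).2 hbot)) hm hA

/-- The same for a SIMPLE abelian variety of type `(K; Φ)` (simple ⟺ primitive, tree). [cite: Shimura1998, §8.2 Prop. 26]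
[cite: MoonenZarhin1998WeilClasses, Criterion (Q2)] -/
theorem four_mul_choose_le_finrank_sub_of_isSimple (hexp : ∀ g : K ≃ₐ[ℚ] K, g ^ 2 = 1) (Φ : CMType K) {m : ℕ}
    (hm : finrank ℚ K = 8 * m) (hA : IsCMTypeRealisation Φ A ι θ) (hs : A.IsSimple) :
    4 * Nat.choose (finrank ℚ K / 2 + 1 - cmTypeRank Φ) 2 ≤
      Module.finrank ℂ ↥(hodgeClassSpan (finrank ℚ K / 2) A.X m) -
        Module.finrank ℂ ↥(divisorClassesSpan A.X (finrank ℚ K / 2) m) := by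
  obtain ⟨φ₀⟩ := (inferInstance : Nonempty (K →+* ℂ))
  exact four_mul_choose_le_finrank_sub hexp φ₀ Φ ((isSimple_iff_isPrimitive hA φ₀).1 hs) hm hA

/-- **In terms of the Weil imaginary quadratic subfields**: `dim Bᵐ(A) − dim Dᵐ(A) ≥ 4·C(w, 2)`, `8m = [K:ℚ]`,
`w = #{F : Φ balanced over F}`. [cite: MoonenZarhin1998WeilClasses, Criterion (Q1) and Criterion (Q2)] [cite: Dodson1984, §3.1.1 Theorem] -/
theorem four_mul_choose_ncard_weilQuadratic_le_finrank_sub (hexp : ∀ g : K ≃ₐ[ℚ] K, g ^ 2 = 1) (φ₀ : K →+* ℂ)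
    (Φ : CMType K) (hprim : IsPrimitive (ℂ ≃+* ℂ) Φ.1 φ₀) {m : ℕ} (hm : finrank ℚ K = 8 * m)
    (hA : IsCMTypeRealisation Φ A ι θ) :
    4 * Nat.choose {F : IntermediateField ℚ K | finrank ℚ F = 2 ∧ ¬ IsTotallyReal F ∧
        ∀ τ : F →+* ℂ, {φ : K →+* ℂ | φ.comp (algebraMap F K) = τ ∧ φ ∈ Φ.1}.ncard =
          {φ : K →+* ℂ | φ.comp (algebraMap F K) = τ ∧ φ ∉ Φ.1}.ncard}.ncard 2 ≤
      Module.finrank ℂ ↥(hodgeClassSpan (finrank ℚ K / 2) A.X m) -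
        Module.finrank ℂ ↥(divisorClassesSpan A.X (finrank ℚ K / 2) m) := by
  have h := four_mul_choose_le_finrank_sub hexp φ₀ Φ hprim hm hA
  have hr := cmTypeRank_add_ncard_weilQuadratic_eq hexp Φ
  have e : finrank ℚ K / 2 + 1 - cmTypeRank Φ = {F : IntermediateField ℚ K | finrank ℚ F = 2 ∧ ¬ IsTotallyReal F ∧
      ∀ τ : F →+* ℂ, {φ : K →+* ℂ | φ.comp (algebraMap F K) = τ ∧ φ ∈ Φ.1}.ncard =
        {φ : K →+* ℂ | φ.comp (algebraMap F K) = τ ∧ φ ∉ Φ.1}.ncard}.ncard := by omega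
  rw [e] at h
  exact h

/-- **AN EXCEPTIONAL HODGE CLASS IN CODIMENSION `g/4`**: if a primitive `Φ` has TWO Weil imaginary quadratic subfields
(`Rank(Φ) ≤ g − 1`, `8m = [K:ℚ]`), every realisation `A` carries a rational `(m,m)`-class outside `Dᵐ(A) ⊗ ℂ` — a Weil
class of the biquadratic CM subfield they generate. [cite: MoonenZarhin1998WeilClasses, Criterion (Q1) and Criterion (Q2)]
[cite: vanGeemen1994HodgeAV, Thm. 4.5 and 4.7] [cite: Gordon1999HodgeAVSurvey, 9.2.2] -/
theorem exists_exceptional_quarter (hexp : ∀ g : K ≃ₐ[ℚ] K, g ^ 2 = 1) (φ₀ : K →+* ℂ) (Φ : CMType K)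
    (hprim : IsPrimitive (ℂ ≃+* ℂ) Φ.1 φ₀) {m : ℕ} (hm : finrank ℚ K = 8 * m)
    (hrank : cmTypeRank Φ + 2 ≤ finrank ℚ K / 2 + 1) (hA : IsCMTypeRealisation Φ A ι θ) :
    ∃ c : complexBetti A.X (2 * m), IsRationalClass c ∧
      IsOfHodgeType (finrank ℚ K / 2) A.X (2 * m) m m c ∧ c ∉ divisorClassesSpan A.X (finrank ℚ K / 2) m := by
  rw [exists_exceptional_iff hA m]
  have h := four_mul_choose_le_finrank_sub hexp φ₀ Φ hprim hm hA
  rw [finrank_hodgeClassSpan_sub_finrank_divisorClassesSpan hA m] at h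
  have hpos : 0 < Nat.choose (finrank ℚ K / 2 + 1 - cmTypeRank Φ) 2 := Nat.choose_pos (by omega)
  exact Set.nonempty_of_ncard_ne_zero (by omega)

end Count

/-! ## §3 Degree `32`: sixty exceptional Weil classes in `H^{4,4}` of every simple degenerate CM `16`-fold -/

section ThirtyTwo

variable {K : Type} [Field K] [NumberField K] [IsCMField K] [IsGalois ℚ K]
  {A : AbelianVariety ℂ} {ι : 𝓞 K →+* End A} {θ : K →+* Module.End ℂ (complexBetti A.X 1)}

/-- **`[K:ℚ] = 32`: `dim B⁴(A) − dim D⁴(A) ≥ 60` FOR EVERY SIMPLE DEGENERATE ABELIAN `16`-FOLD `A` WITH COMPLEX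
MULTIPLICATION BY `K`** — its type has rank `11`, it is of Weil type over `6` imaginary quadratic and `15 = C(6,2)`
biquadratic CM subfields, each of the latter carrying `4` exceptional Weil lines in `H⁸(A) = H^{4,4}` (codimension `4`).
[cite: MoonenZarhin1998WeilClasses, Criterion (Q1) and Criterion (Q2)] [cite: Gordon1999HodgeAVSurvey, 9.2.2 and 5.13 (ii)]
[cite: Dodson1984, §3.1.1 Theorem and §3.2.1] [cite: Pohlmann1968, Thm. 1] -/
theorem sixty_le_finrank_sub_of_finrank_eq_thirtytwo (hexp : ∀ g : K ≃ₐ[ℚ] K, g ^ 2 = 1) (h32 : finrank ℚ K = 32)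
    (Φ : CMType K) (hA : IsCMTypeRealisation Φ A ι θ) (hs : A.IsSimple) (hnd : ¬ IsNondegenerate Φ) :
    60 ≤ Module.finrank ℂ ↥(hodgeClassSpan (finrank ℚ K / 2) A.X 4) -
        Module.finrank ℂ ↥(divisorClassesSpan A.X (finrank ℚ K / 2) 4) := by
  have h := four_mul_choose_le_finrank_sub_of_isSimple hexp Φ (m := 4) (by rw [h32]) hA hs
  have hr := cmTypeRank_eq_eleven_of_isSimple_of_not_isNondegenerate hexp h32 Φ hA hs hnd
  have e : 4 * Nat.choose (finrank ℚ K / 2 + 1 - cmTypeRank Φ) 2 = 60 := by rw [hr, h32]; decide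
  rw [e] at h
  exact h

/-- **… in particular a rational `(4,4)`-class outside `D⁴(A) ⊗ ℂ`** — an exceptional Hodge class in CODIMENSION `4`
on every simple degenerate `16`-fold with complex multiplication by `K`, `[K:ℚ] = 32` (gen 45: codimension `8`).
[cite: MoonenZarhin1998WeilClasses, Criterion (Q2)] [cite: vanGeemen1994HodgeAV, Thm. 4.5 and 4.7] [cite: Gordon1999HodgeAVSurvey, 9.2.2] -/
theorem exists_exceptional_four_of_finrank_eq_thirtytwo (hexp : ∀ g : K ≃ₐ[ℚ] K, g ^ 2 = 1)
    (h32 : finrank ℚ K = 32) (Φ : CMType K) (hA : IsCMTypeRealisation Φ A ι θ) (hs : A.IsSimple)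
    (hnd : ¬ IsNondegenerate Φ) :
    ∃ c : complexBetti A.X (2 * 4), IsRationalClass c ∧
      IsOfHodgeType (finrank ℚ K / 2) A.X (2 * 4) 4 4 c ∧ c ∉ divisorClassesSpan A.X (finrank ℚ K / 2) 4 := by
  obtain ⟨φ₀⟩ := (inferInstance : Nonempty (K →+* ℂ))
  have hr := cmTypeRank_eq_eleven_of_isSimple_of_not_isNondegenerate hexp h32 Φ hA hs hnd
  exact exists_exceptional_quarter hexp φ₀ Φ ((isSimple_iff_isPrimitive hA φ₀).1 hs) (m := 4) (by rw [h32])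
    (by rw [hr, h32]; norm_num) hA

/-- **EXISTENCE** (`[K:ℚ] = 32`): every multiquadratic CM field of degree `32` carries a CM type (primitive, rank `11`)
all of whose abelian varieties are simple `16`-folds with `dim B⁴ − dim D⁴ ≥ 60`, and such an abelian variety exists.
[cite: Shimura1998, §6.2 Thm. 3] [cite: MoonenZarhin1998WeilClasses, Criterion (Q2)] [cite: Dodson1984, §3.2.1] -/
theorem exists_isSimple_sixteenfold_sixty_of_finrank_eq_thirtytwo (hexp : ∀ g : K ≃ₐ[ℚ] K, g ^ 2 = 1)
    (h32 : finrank ℚ K = 32) :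
    ∃ (Φ : CMType K) (A : AbelianVariety ℂ) (ι : 𝓞 K →+* End A) (θ : K →+* Module.End ℂ (complexBetti A.X 1)),
      IsCMTypeRealisation Φ A ι θ ∧ cmTypeRank Φ = 11 ∧ A.IsSimple ∧ A.dim = 16 ∧
        60 ≤ Module.finrank ℂ ↥(hodgeClassSpan (finrank ℚ K / 2) A.X 4) -
          Module.finrank ℂ ↥(divisorClassesSpan A.X (finrank ℚ K / 2) 4) := by
  obtain ⟨Φ, hr, hnd, -⟩ := exists_isPrimitive_cmTypeRank_eq_eleven hexp h32
  obtain ⟨A, ι, θ, hA⟩ := exists_isCMTypeRealisation Φ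
  have hs : A.IsSimple := (isSimple_iff_cmTypeRank_eq_eleven_or_seventeen hexp h32 Φ hA).2 (Or.inl hr)
  have hdim : A.dim = finrank ℚ K / 2 := Literature.AlgebraicGeometry.Motives.schemeDim_eq_holds hA.1
  exact ⟨Φ, A, ι, θ, hA, hr, hs, by rw [hdim, h32],
    sixty_le_finrank_sub_of_finrank_eq_thirtytwo hexp h32 Φ hA hs hnd⟩

end ThirtyTwo

/-! ## §4 Degree `64`: primitive types of rank `17` (e.g. near-bent): `dim B⁸ − dim D⁸ ≥ 480` -/

section SixtyFour

variable {K : Type} [Field K] [NumberField K] [IsCMField K] [IsGalois ℚ K]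
  {A : AbelianVariety ℂ} {ι : 𝓞 K →+* End A} {θ : K →+* Module.End ℂ (complexBetti A.X 1)}

/-- **`[K:ℚ] = 64`, `Φ` PRIMITIVE OF RANK `17`: `dim B⁸(A) − dim D⁸(A) ≥ 480 = 4·C(16, 2)`** for every abelian variety of
type `(K; Φ)` — a simple `32`-fold of Weil type over `16` imaginary quadratic and `120` biquadratic CM subfields (e.g.
the primitive near-bent types of the tree). [cite: MoonenZarhin1998WeilClasses, Criterion (Q1) and Criterion (Q2)]
[cite: Gordon1999HodgeAVSurvey, 9.2.2] [cite: Dodson1984, §3.1.1 Theorem] -/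
theorem four_hundred_eighty_le_finrank_sub_of_finrank_eq_sixtyFour (hexp : ∀ g : K ≃ₐ[ℚ] K, g ^ 2 = 1)
    (h64 : finrank ℚ K = 64) (Φ : CMType K) (h1 : Nat.card (twistStabilizer Φ) = 1) (hr : cmTypeRank Φ = 17)
    (hA : IsCMTypeRealisation Φ A ι θ) :
    480 ≤ Module.finrank ℂ ↥(hodgeClassSpan (finrank ℚ K / 2) A.X 8) -
        Module.finrank ℂ ↥(divisorClassesSpan A.X (finrank ℚ K / 2) 8) := by
  have hbot : twistStabilizer Φ = ⊥ := Subgroup.eq_bot_of_card_eq (twistStabilizer Φ) h1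
  have h := four_mul_choose_le_finrank_sub_of_twistStabilizer_eq_bot hexp Φ hbot (m := 8) (by rw [h64]) hA
  have e : 4 * Nat.choose (finrank ℚ K / 2 + 1 - cmTypeRank Φ) 2 = 480 := by rw [hr, h64]; decide
  rw [e] at h
  exact h

/-- **EXISTENCE** (`[K:ℚ] = 64`): a primitive near-bent CM type (tree) gives simple `32`-folds with
`dim B⁸ − dim D⁸ ≥ 480`; such an abelian variety exists over every multiquadratic CM field of degree `64`.
[cite: Shimura1998, §6.2 Thm. 3] [cite: MoonenZarhin1998WeilClasses, Criterion (Q2)] [cite: Carlet2020, §6.2.4] -/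
theorem exists_isSimple_thirtyTwofold_fourHundredEighty_of_finrank_eq_sixtyFour (hexp : ∀ g : K ≃ₐ[ℚ] K, g ^ 2 = 1)
    (h64 : finrank ℚ K = 64) :
    ∃ (Φ : CMType K) (A : AbelianVariety ℂ) (ι : 𝓞 K →+* End A) (θ : K →+* Module.End ℂ (complexBetti A.X 1)),
      IsCMTypeRealisation Φ A ι θ ∧ cmTypeRank Φ = 17 ∧ A.IsSimple ∧ A.dim = 32 ∧
        480 ≤ Module.finrank ℂ ↥(hodgeClassSpan (finrank ℚ K / 2) A.X 8) -
          Module.finrank ℂ ↥(divisorClassesSpan A.X (finrank ℚ K / 2) 8) := by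
  obtain ⟨φ₀⟩ := (inferInstance : Nonempty (K →+* ℂ))
  obtain ⟨Φ, -, h1, hr, -, hall⟩ := exists_isSimple_exceptional_nearBent_of_finrank_eq_sixtyFour hexp φ₀ h64
  obtain ⟨A, ι, θ, hA⟩ := exists_isCMTypeRealisation Φ
  obtain ⟨hS, hd, -⟩ := hall A ι θ hA
  exact ⟨Φ, A, ι, θ, hA, hr, hS, hd,
    four_hundred_eighty_le_finrank_sub_of_finrank_eq_sixtyFour hexp h64 Φ h1 hr hA⟩

end SixtyFour

end MultiquadraticWeilSubfieldsClasses

end Literature.AlgebraicGeometry.Pohlmann1968
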